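import Mathlib

/-!
# T5FiniteZeros — a non-zero power series over a complete DVR has finitely many zeros

Kernel form of route-3 §G step S5 [P3 + A-4] (route/T5-route-3.md v0.4 §G, Proposition G,
the printed replacement of the BHTY preprint for the L-value half of [G-N5.1]): a non-zero
`𝒪`-valued measure on `Γ_𝔭 ≅ ℤ_p` is a non-zero power series `f ∈ 𝒪⟦T⟧`, its integral against a
finite-order character `ν` with `ν(γ₀) = ζ` is `f(ζ − 1)`, and Weierstrass preparation
`f = ϖ^μ · P · U` (`P` distinguished, `U` a unit) forces `f(a) = 0 ⇒ P(a) = 0`, so at most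
`deg P` of the points `ζ − 1` are zeros.

Nothing arithmetic is asserted here. Evaluation at a point is abstracted as an `A`-algebra
homomorphism `ev : A⟦X⟧ →ₐ[A] A` (Mathlib's `PowerSeries.aeval` provides one for every
topologically nilpotent `a` of a complete linearly topologised ring — `finite_aevalZeroSet`
below is that instance); the Weierstrass factorisation is Mathlib's
`PowerSeries.exists_isWeierstrassFactorization` (complete local ring, image of the series in the
residue field non-zero); the extraction of `ϖ^μ` is proved here for a discrete valuation ring
(`exists_eq_C_pow_mul`).
-/

namespace Summit.Ventures.HodgeRepro2.T5FiniteZeros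

open PowerSeries Polynomial

variable {A : Type*} [CommRing A]

/-- An `A`-algebra homomorphism `A⟦X⟧ → A` evaluates a polynomial (coerced to a power series)
at the image of `X`. -/
theorem algHom_coe_eq_eval (ev : A⟦X⟧ →ₐ[A] A) (P : A[X]) :
    ev (P : A⟦X⟧) = P.eval (ev PowerSeries.X) := by
  have h : ev.comp (Polynomial.coeToPowerSeries.algHom A) =
      Polynomial.aeval (ev PowerSeries.X) := by
    apply Polynomial.algHom_ext
    simp
  have h' := DFunLike.congr_fun h P
  simp only [AlgHom.comp_apply, Polynomial.coeToPowerSeries.algHom_apply,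
    Algebra.algebraMap_self, PowerSeries.map_id, id_eq] at h'
  rw [h', ← Polynomial.coe_aeval_eq_eval]

/-- An `A`-algebra homomorphism `A⟦X⟧ → A` is the identity on constants. -/
theorem algHom_C (ev : A⟦X⟧ →ₐ[A] A) (c : A) : ev (PowerSeries.C c) = c := by
  rw [PowerSeries.C_eq_algebraMap, AlgHom.commutes, Algebra.algebraMap_self, RingHom.id_apply]

/-- The pointwise core: if `f = C c * (P * U)` with `c ≠ 0`, `P` a polynomial and `U` a unit of
`A⟦X⟧` (`A` a domain), then `ev f = 0` forces `ev X` to be a root of `P`. -/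
theorem isRoot_of_eval_eq_zero [IsDomain A] {f : A⟦X⟧} {c : A} (hc : c ≠ 0)
    {P : A[X]} {U : A⟦X⟧} (hU : IsUnit U) (hf : f = PowerSeries.C c * ((P : A⟦X⟧) * U))
    (ev : A⟦X⟧ →ₐ[A] A) (h0 : ev f = 0) : P.IsRoot (ev PowerSeries.X) := by
  have hU' : ev U ≠ 0 := (hU.map ev).ne_zero
  have h : c * (P.eval (ev PowerSeries.X) * ev U) = 0 := by
    rw [hf, map_mul, map_mul, algHom_coe_eq_eval, algHom_C] at h0
    exact h0
  rcases mul_eq_zero.1 h with h | h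
  · exact absurd h hc
  · rcases mul_eq_zero.1 h with h | h
    · exact h
    · exact absurd h hU'

/-- The zero set of such an `f` under a family of evaluations `ev a` with `ev a X = a` is
finite (contained in the roots of `P`). -/
theorem finite_zeroSet [IsDomain A] {f : A⟦X⟧} {c : A} (hc : c ≠ 0) {P : A[X]} (hP : P ≠ 0)
    {U : A⟦X⟧} (hU : IsUnit U) (hf : f = PowerSeries.C c * ((P : A⟦X⟧) * U))
    (ev : A → (A⟦X⟧ →ₐ[A] A)) (hev : ∀ a, ev a PowerSeries.X = a) :
    {a : A | ev a f = 0}.Finite := by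
  refine (Polynomial.finite_setOf_isRoot hP).subset ?_
  intro a ha
  have h := isRoot_of_eval_eq_zero hc hU hf (ev a) ha
  rwa [hev a] at h

/-- A power series with a unit coefficient has non-zero image in the residue field. -/
theorem map_residue_ne_zero_of_isUnit_coeff [IsLocalRing A] {g : A⟦X⟧} {n : ℕ}
    (hn : IsUnit (PowerSeries.coeff n g)) : g.map (IsLocalRing.residue A) ≠ 0 := by
  intro h
  have h1 : IsLocalRing.residue A (PowerSeries.coeff n g) = 0 := by
    have h2 := congrArg (PowerSeries.coeff n) h
    rwa [PowerSeries.coeff_map, map_zero] at h2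
  rw [IsLocalRing.residue_eq_zero_iff] at h1
  exact mem_nonunits_iff.1 ((IsLocalRing.mem_maximalIdeal _).1 h1) hn

/-- In a discrete valuation ring with uniformiser `ϖ`, a non-zero power series is `ϖ^μ` times a
power series with a unit coefficient (the `ϖ^μ` of route-3 §G S5). -/
theorem exists_eq_C_pow_mul [IsDomain A] [IsDiscreteValuationRing A] {ϖ : A}
    (hϖ : Irreducible ϖ) {f : A⟦X⟧} (hf : f ≠ 0) :
    ∃ (μ : ℕ) (g : A⟦X⟧), f = PowerSeries.C (ϖ ^ μ) * g ∧ ∃ n, IsUnit (PowerSeries.coeff n g) := by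
  classical
  have hex : ∃ m, ∃ n, ¬ ϖ ^ (m + 1) ∣ PowerSeries.coeff n f := by
    obtain ⟨n, hn⟩ : ∃ n, PowerSeries.coeff n f ≠ 0 := by
      by_contra h
      refine hf (PowerSeries.ext fun n => ?_)
      rw [map_zero]
      exact Classical.by_contradiction fun hn => h ⟨n, hn⟩
    obtain ⟨k, u, hk⟩ := IsDiscreteValuationRing.eq_unit_mul_pow_irreducible hn hϖ
    refine ⟨k, n, fun hdvd => ?_⟩
    rw [hk, pow_succ, mul_comm (u : A)] at hdvd
    have h1 : ϖ ∣ (u : A) := (mul_dvd_mul_iff_left (pow_ne_zero k hϖ.ne_zero)).1 hdvd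
    exact hϖ.not_isUnit (isUnit_of_dvd_unit h1 u.isUnit)
  let μ := Nat.find hex
  have hμ : ∃ n, ¬ ϖ ^ (μ + 1) ∣ PowerSeries.coeff n f := Nat.find_spec hex
  have hall : ∀ n, ϖ ^ μ ∣ PowerSeries.coeff n f := by
    intro n
    rcases Nat.eq_zero_or_pos μ with h0 | hpos
    · rw [h0, pow_zero]
      exact one_dvd _
    · have hmin := Nat.find_min hex (Nat.sub_lt hpos Nat.one_pos)
      have h : ϖ ^ (μ - 1 + 1) ∣ PowerSeries.coeff n f :=
        Classical.by_contradiction fun hnd => hmin ⟨n, hnd⟩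
      rwa [Nat.sub_add_cancel hpos] at h
  choose q hq using hall
  refine ⟨μ, PowerSeries.mk q, ?_, ?_⟩
  · ext n
    rw [PowerSeries.coeff_C_mul, PowerSeries.coeff_mk, hq n]
  · obtain ⟨n, hn⟩ := hμ
    refine ⟨n, ?_⟩
    rw [PowerSeries.coeff_mk]
    by_contra hnu
    apply hn
    have hmem : q n ∈ IsLocalRing.maximalIdeal A :=
      (IsLocalRing.mem_maximalIdeal _).2 (mem_nonunits_iff.2 hnu)
    rw [hϖ.maximalIdeal_eq, Ideal.mem_span_singleton] at hmem
    rw [hq n, pow_succ]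
    exact mul_dvd_mul_left _ hmem

/-- THEOREM (§G S5 in kernel form). Over a complete discrete valuation ring, for every non-zero
power series `f` there is a non-zero polynomial `P` such that every `A`-algebra evaluation
`ev : A⟦X⟧ →ₐ[A] A` killing `f` sends `X` to a root of `P`. -/
theorem exists_poly_of_ne_zero [IsDomain A] [IsDiscreteValuationRing A]
    [IsAdicComplete (IsLocalRing.maximalIdeal A) A] {f : A⟦X⟧} (hf : f ≠ 0) :
    ∃ P : A[X], P ≠ 0 ∧ ∀ ev : A⟦X⟧ →ₐ[A] A, ev f = 0 → P.IsRoot (ev PowerSeries.X) := by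
  obtain ⟨ϖ, hϖ⟩ := IsDiscreteValuationRing.exists_irreducible A
  obtain ⟨μ, g, hfg, n, hn⟩ := exists_eq_C_pow_mul hϖ hf
  have hg := map_residue_ne_zero_of_isUnit_coeff hn
  obtain ⟨P, U, H⟩ := g.exists_isWeierstrassFactorization hg
  have hP : P ≠ 0 := H.isDistinguishedAt.monic.ne_zero
  have hf' : f = PowerSeries.C (ϖ ^ μ) * ((P : A⟦X⟧) * U) := by rw [hfg, H.eq_mul]
  exact ⟨P, hP, fun ev h0 =>
    isRoot_of_eval_eq_zero (pow_ne_zero μ hϖ.ne_zero) H.isUnit hf' ev h0⟩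

/-- COROLLARY (the finite exceptional set of §G S5). Over a complete discrete valuation ring, a
non-zero power series has finitely many zeros under any family of evaluations `ev a` with
`ev a X = a`. -/
theorem finite_zeroSet_of_ne_zero [IsDomain A] [IsDiscreteValuationRing A]
    [IsAdicComplete (IsLocalRing.maximalIdeal A) A] {f : A⟦X⟧} (hf : f ≠ 0)
    (ev : A → (A⟦X⟧ →ₐ[A] A)) (hev : ∀ a, ev a PowerSeries.X = a) :
    {a : A | ev a f = 0}.Finite := by
  obtain ⟨P, hP, hroot⟩ := exists_poly_of_ne_zero hf
  refine (Polynomial.finite_setOf_isRoot hP).subset ?_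
  intro a ha
  have h := hroot (ev a) ha
  rwa [hev a] at h

/-- The exceptional set of a family indexed injectively by the evaluation points (the characters
`ν ↦ ζ_ν − 1` of §G S5) is finite. -/
theorem finite_preimage {Ξ : Type*} [IsDomain A] [IsDiscreteValuationRing A]
    [IsAdicComplete (IsLocalRing.maximalIdeal A) A] {f : A⟦X⟧} (hf : f ≠ 0)
    (ev : A → (A⟦X⟧ →ₐ[A] A)) (hev : ∀ a, ev a PowerSeries.X = a)
    (ι : Ξ → A) (hι : Function.Injective ι) : {ν : Ξ | ev (ι ν) f = 0}.Finite :=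
  (finite_zeroSet_of_ne_zero hf ev hev).preimage hι.injOn

/-- The same with Mathlib's evaluation `PowerSeries.aeval`: over a complete discrete valuation
ring that is complete and Hausdorff as a linearly topologised ring, a non-zero power series
vanishes at only finitely many topologically nilpotent points. -/
theorem finite_aevalZeroSet [UniformSpace A] [IsUniformAddGroup A] [IsTopologicalRing A]
    [T2Space A] [CompleteSpace A] [IsLinearTopology A A] [IsDomain A]
    [IsDiscreteValuationRing A] [IsAdicComplete (IsLocalRing.maximalIdeal A) A]
    {f : A⟦X⟧} (hf : f ≠ 0) :
    {a : A | ∃ ha : PowerSeries.HasEval a, PowerSeries.aeval (R := A) (S := A) ha f = 0}.Finite := by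
  obtain ⟨P, hP, hroot⟩ := exists_poly_of_ne_zero hf
  refine (Polynomial.finite_setOf_isRoot hP).subset ?_
  rintro a ⟨ha, h0⟩
  have h := hroot (PowerSeries.aeval (R := A) (S := A) ha) h0
  have hX : PowerSeries.aeval (R := A) (S := A) ha PowerSeries.X = a := by
    simpa using PowerSeries.aeval_coe (R := A) (S := A) ha (Polynomial.X : Polynomial A)
  rwa [hX] at h

end Summit.Ventures.HodgeRepro2.T5FiniteZeros
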